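import Summits.ABC.IUTFork.Thm311RealLog
import Literature.IUT.LogVolume.UnitLogZetaThreeCompletion
import HarnessLib

/-!
# [IUTchIII] Thm 3.11 over real definitions: the log-shell at the RAMIFIED place of `ℚ(ζ₃)` is `𝒪_v` exactly

Proof-only file (theorems, no definitions) of the abc-iut cell; TAKES NO SIDE on [IUTchIII] Cor. 3.12.
Team R's `ζ₃`-instance of the identified-copies mover (`Cor312RamifiedPlaceData.lean`,
`RamifiedMover.K3 := CyclotomicField 3 ℚ`, the place `v₃ = (ζ₃ - 1)` above `3`) carries the hypothesis
(GAP-LEDGER row G-c312-14-1)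

  `hshell : ∃ logv : PadicLogs K3, LogvLaw logv ∧ ∃ c₀ ≠ 0, shell logv (.inr v₃) = c₀ • 𝒪_{v₃}`

— an actual family of `p_v`-adic logarithms obeying the law of `Thm311RealDH` whose log-shell at `v₃` is
BALL-SHAPED. Both parts are now theorems: the analytic family `Real.analyticLogv K3` (abc-iut-c312-5 over
abc-iut-L5-t5 / abc-iut-S1 / abc-iut-S7) satisfies `LogvLaw` (`logvLaw_analyticLogv`), and by the
classical computation of `Literature.IUT.LogVolume.UnitLogZetaThree(Completion)` (residue field `𝔽₃`,
`ζ₃ - 1` a uniformizer: `u⁶ ∈ 1 + 9𝒪_v` for every unit, so `log_v(𝒪_v^×) = 3·𝒪_v`) its shell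
`ℐ_v = 3⁻¹ · log_v(𝒪_v^×)` at `v ∣ 3` is `𝒪_v` ITSELF (`c₀ = 1`; in particular NOT `λ⁻¹·𝒪_v`).

* `Real.shell_analyticLogv_eq_integers_of_isCyclotomic_three` — for any `F` with
  `IsCyclotomicExtension {3} ℚ F` and any finite place `v ∋ 3`: `shell (analyticLogv F) v = 𝒪_v`;
* `Real.exists_logvLaw_shell_eq_smul_integers_of_isCyclotomic_three` — the `hshell` shape with `c₀ = 1`;
* `RamifiedMover.shell_analyticLogv_K3` / `RamifiedMover.hshell_K3` — the same at
  `K3 = CyclotomicField 3 ℚ` (stated for every place `v ∋ 3` of `K3`; there is exactly one).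

[cite: NeukirchANT1999, Ch. II Prop. (5.5)] [claim: Mochizuki2012, status: disputed] (the claim tag
records only that `shell` / `LogvLaw` transcribe [IUTchIII] Rmk. 1.2.2 (i); the mathematics here is
classical). typed ≠ discharged; instantiated ≠ endorsed.
-/

noncomputable section

open scoped Pointwise

namespace Summit.ABC.IUTFork.Thm311.Real

open NumberField IsDedekindDomain Literature.IUT.LogVolume Literature.IUT.LogThetaLattice

variable (F : Type) [Field F] [NumberField F] [IsCyclotomicExtension {3} ℚ F]
  (v : HeightOneSpectrum (𝓞 F)) (hv : ((3 : ℕ) : 𝓞 F) ∈ v.asIdeal)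

include hv in
/-- **`ℐ_v = 𝒪_v` at the ramified place of `ℚ(ζ₃)` for the analytic logarithms**: the instantiated
log-shell `Real.shell (analyticLogv F) v = (p_v^*)⁻¹ · log_v(𝒪_v^×)` ([IUTchIII] Rmk. 1.2.2 (i)) at a
place `v ∋ 3` of an `IsCyclotomicExtension {3} ℚ F` is EXACTLY the ring of integers
(`Literature.IUT.LogVolume.nonarchLogShell_adicCompletion_eq_integers'` at `p_v = 3`).
[cite: NeukirchANT1999, Ch. II Prop. (5.5)] -/
theorem shell_analyticLogv_eq_integers_of_isCyclotomic_three :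
    shell (analyticLogv F) (.inr v) =
      ((integers v : ValuationSubring (Carrier (.inr v : Place F))) : Set (Carrier (.inr v : Place F))) := by
  rw [shell_inr]
  haveI : Fact (residueChar F v).Prime := ⟨residueChar_prime F v⟩
  exact nonarchLogShell_adicCompletion_eq_integers' F v (residueChar F v) (natCast_residueChar_mem F v)
    (residueChar_eq_three F v hv) (analyticLogv F v) (analyticLogv_apply F v)

include hv in
/-- **The `hshell` shape of GAP-LEDGER row G-c312-14-1, PROVED with `c₀ = 1`**: there is a family of
`p_v`-adic logarithms obeying `Real.LogvLaw` (namely the analytic one) whose log-shell at the place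
`v ∋ 3` of `ℚ(ζ₃)` is the ball `1 · 𝒪_v`. [cite: NeukirchANT1999, Ch. II Prop. (5.5)] -/
theorem exists_logvLaw_shell_eq_smul_integers_of_isCyclotomic_three :
    ∃ logv : PadicLogs F, LogvLaw logv ∧ ∃ c₀ : Carrier (.inr v : Place F), c₀ ≠ 0 ∧
      shell logv (.inr v) =
        c₀ • ((integers v : ValuationSubring (Carrier (.inr v : Place F))) :
          Set (Carrier (.inr v : Place F))) :=
  ⟨analyticLogv F, logvLaw_analyticLogv F, 1, one_ne_zero, by
    rw [shell_analyticLogv_eq_integers_of_isCyclotomic_three F v hv, one_smul]⟩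

end Summit.ABC.IUTFork.Thm311.Real

namespace Summit.ABC.IUTFork.RamifiedMover

open NumberField IsDedekindDomain Summit.ABC.IUTFork.Thm311.Real

/-- **At `K3 = ℚ(ζ₃)` (`CyclotomicField 3 ℚ`, = `RamifiedMover.K3` by `rfl`; the cyclotomic instance is supplied by
name as in `Cor312RamifiedPlaceData.cycInst`)**: for every finite place
`v ∋ 3` (there is exactly one, `(ζ₃ - 1)`), the analytic log-shell is `𝒪_v`.
[cite: NeukirchANT1999, Ch. II Prop. (5.5)] -/
theorem shell_analyticLogv_K3 (v : HeightOneSpectrum (𝓞 (CyclotomicField 3 ℚ)))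
    (hv : ((3 : ℕ) : 𝓞 (CyclotomicField 3 ℚ)) ∈ v.asIdeal) :
    shell (analyticLogv (CyclotomicField 3 ℚ)) (.inr v) =
      ((integers v : ValuationSubring (Carrier (.inr v : Place (CyclotomicField 3 ℚ)))) :
        Set (Carrier (.inr v : Place (CyclotomicField 3 ℚ)))) := by
  haveI : IsCyclotomicExtension {3} ℚ (CyclotomicField 3 ℚ) := CyclotomicField.isCyclotomicExtension 3 ℚ
  exact shell_analyticLogv_eq_integers_of_isCyclotomic_three (CyclotomicField 3 ℚ) v hv

/-- **`hshell` for the `ζ₃`-instance, discharged** (GAP-LEDGER G-c312-14-1): at every place `v ∋ 3` of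
`K3 = CyclotomicField 3 ℚ` there is a law-abiding family of `p`-adic logarithms (the analytic one) with
ball-shaped shell `shell logv v = c₀ • 𝒪_v`, `c₀ = 1 ≠ 0`. [cite: NeukirchANT1999, Ch. II Prop. (5.5)] -/
theorem hshell_K3 (v : HeightOneSpectrum (𝓞 (CyclotomicField 3 ℚ)))
    (hv : ((3 : ℕ) : 𝓞 (CyclotomicField 3 ℚ)) ∈ v.asIdeal) :
    ∃ logv : PadicLogs (CyclotomicField 3 ℚ), LogvLaw logv ∧
      ∃ c₀ : Carrier (.inr v : Place (CyclotomicField 3 ℚ)), c₀ ≠ 0 ∧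
        shell logv (.inr v) =
          c₀ • ((integers v : ValuationSubring (Carrier (.inr v : Place (CyclotomicField 3 ℚ)))) :
            Set (Carrier (.inr v : Place (CyclotomicField 3 ℚ)))) := by
  haveI : IsCyclotomicExtension {3} ℚ (CyclotomicField 3 ℚ) := CyclotomicField.isCyclotomicExtension 3 ℚ
  exact exists_logvLaw_shell_eq_smul_integers_of_isCyclotomic_three (CyclotomicField 3 ℚ) v hv

end Summit.ABC.IUTFork.RamifiedMover

end
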